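import Literature.NumberTheory.LFunctions.ZeroSumWindowBounds
import Literature.NumberTheory.LFunctions.DHCharInequality
import Literature.NumberTheory.LFunctions.DHZetaInequality
import HarnessLib

/-!
# The error terms of the Deuring–Heilbronn inequalities: far zeros, left lines, trivial zeros

Topic `Literature/NumberTheory/LFunctions`, sub-namespace `DHTest`. Everything here is PROVED
(no definitions). For the test function `g = testFn x₀ ε₂ ε₀ L α` (`F₀ = fordLaplace₀ g`,
`H = shapeLaplace h x₀`, `h₀ = h(0)`), `s = σ₀ + it` with `1 < σ₀` and the near-zero sets
`T = nearZeros χ t δ` / `nearZerosZeta t δ` of `DHCharInequality` / `DHZetaInequality`: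

* `norm_tsum_compl_le` — `‖Σ_{i ∉ T} f i‖ ≤ Σ_i g i` when `‖f i‖ ≤ g i` off `T` (`g ≥ 0` summable);
* `norm_far_char_le`, `norm_far_zeta_le` — **the far zeros** (Heath-Brown 1992, proof of Lemma 5.2:
  "if `|1+it−ρ| ≥ δ` then `|s−ρ| ≫ |1+it−ρ|` and `F₀((s−ρ)L) ≪ L⁻²|1+it−ρ|⁻²` … Lemma 3.3 yields"):
  `‖Σ_{ρ∉T} m(ρ)F₀(s−ρ)‖ ≤ (C/δ²)·ℒ·C_far`, where
  `C_far = 2h₀α/L + Σ_{1≤j<k} |h^{(j)}(0)|(2/δ)^{j−1}/L^j + x₀M_k e^{αx₀}(2/δ)^{k−2}/L^{k−1}`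
  (the last term is the only one carrying `e^{αx₀}`), from
  `DHTest.norm_fordLaplace₀_testFn_le_of_re_pos` and `Σ m/(c²+(γ−t)²) ≤ (C/c²)ℒ`
  (`ZeroSumWindowBounds`);
* `norm_charEFRemainder_testFn_le`, `exists_norm_smoothedEFRemainder_le`,
  `norm_smoothedEFRemainder_testFn_le` — **the left lines** are `O(B ℒ)` with
  `B = 2h₀α/L + 4|h'(0)|/L + 16M₂/L²` (no `e^{αx₀}`);
* `norm_trivial_testFn_le` — the trivial-zero terms are `≤ 2B`;
* `norm_shapeLaplace_le_of_norm_ge` — `L‖H(W)‖ ≤ L(Σ_{j<k}|h^{(j)}(0)|/‖W‖^{j+1} + x₀M_k e^{ax₀}/‖W‖^k)`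
  for `Re W ≥ −a` (the inserted `β₁`-term when `|μ₀| ≥ δL/2`, Heath-Brown (6.14)).

## References

* D. R. Heath-Brown, Proc. London Math. Soc. (3) 64 (1992), Lemma 3.3, Lemma 5.2 (proof), (6.14).
  [cite: HeathBrown1992PLMS, Lemma 5.2 (proof)]
-/

noncomputable section

open Complex Real MeasureTheory Set Filter Topology Metric

namespace Literature.NumberTheory.LFunctions

namespace DHTest

open ExplicitPsiChar LaplaceShape

/-! ### A generic tail estimate -/

/-- `‖Σ_{i ∉ T} f i‖ ≤ Σ_i g i` if `‖f i‖ ≤ g i` for `i ∉ T`, `g ≥ 0` summable, `Σ ‖f‖ < ∞`. [folklore] -/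
theorem norm_tsum_compl_le {ι : Type*} {f : ι → ℂ} {g : ι → ℝ} (T : Finset ι)
    (hf : Summable fun i ↦ ‖f i‖) (hg : Summable g) (hg0 : ∀ i, 0 ≤ g i)
    (hle : ∀ i, i ∉ T → ‖f i‖ ≤ g i) :
    ‖∑' i : ↑((T : Set ι)ᶜ), f i‖ ≤ ∑' i, g i := by
  have h1 : Summable fun i : ↑((T : Set ι)ᶜ) ↦ ‖f i‖ := hf.subtype _
  have h2 : Summable fun i : ↑((T : Set ι)ᶜ) ↦ g i := hg.subtype _
  calc ‖∑' i : ↑((T : Set ι)ᶜ), f i‖ ≤ ∑' i : ↑((T : Set ι)ᶜ), ‖f i‖ := norm_tsum_le_tsum_norm h1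
    _ ≤ ∑' i : ↑((T : Set ι)ᶜ), g i := by
        refine Summable.tsum_le_tsum (fun i ↦ hle i fun h ↦ ?_) h1 h2
        exact (Set.mem_compl_iff _ _).1 i.2 (Finset.mem_coe.2 h)
    _ ≤ ∑' i, g i := hg.tsum_subtype_le g _ hg0

/-! ### Geometry of a far zero -/

/-- For a far zero (`‖ρ − (1+it)‖ > δ`) and a centre `c₀ = σ₀ − α/L` with `|c₀ − 1| ≤ δ/4`:
`‖(s − ρ) − α/L‖ ≥ δ/2` and `≥ |t − Im ρ|`, hence `‖(s−ρ) − α/L‖² ≥ ((δ/2)² + (Im ρ − t)²)/2`;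
and if `α/L ≤ δ/4` then `‖s − ρ‖ ≥ ‖(s−ρ) − α/L‖/2`. [cite: HeathBrown1992PLMS, Lemma 5.2 (proof, |s-ρ| ≫ |1+it-ρ|)] -/
theorem far_geometry {σ₀ t δ a : ℝ} (hδ : 0 < δ) (ha0 : 0 ≤ a) (ha : a ≤ δ / 4)
    (hc : |σ₀ - a - 1| ≤ δ / 4) {ρ : ℂ} (hfar : δ < ‖ρ - (1 + t * I)‖) :
    let z : ℂ := (σ₀ : ℂ) + t * I - ρ
    δ / 2 ≤ ‖z - a‖ ∧ ((δ / 2) ^ 2 + (ρ.im - t) ^ 2) / 2 ≤ ‖z - a‖ ^ 2 ∧ ‖z - a‖ / 2 ≤ ‖z‖ ∧ z - a ≠ 0 := by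
  intro z
  have e : z - a = ((1 : ℂ) + t * I - ρ) + ((σ₀ - a - 1 : ℝ) : ℂ) := by
    simp only [z]; push_cast; ring
  have h1 : δ / 2 ≤ ‖z - a‖ := by
    rw [e]
    have := norm_sub_norm_le ((1 : ℂ) + t * I - ρ) (-(((σ₀ - a - 1 : ℝ) : ℂ)))
    rw [sub_neg_eq_add, norm_neg, Complex.norm_real, Real.norm_eq_abs, norm_sub_rev] at this
    linarith
  have him : |ρ.im - t| ≤ ‖z - a‖ := by
    have := Complex.abs_im_le_norm (z - a)
    have hi : (z - a).im = t - ρ.im := by simp [z]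
    rw [hi, abs_sub_comm] at this
    exact this
  have h2 : ((δ / 2) ^ 2 + (ρ.im - t) ^ 2) / 2 ≤ ‖z - a‖ ^ 2 := by
    have e1 : (δ / 2) ^ 2 ≤ ‖z - a‖ ^ 2 := pow_le_pow_left₀ (by linarith) h1 2
    have e2 : (ρ.im - t) ^ 2 ≤ ‖z - a‖ ^ 2 := by
      rw [← sq_abs]; exact pow_le_pow_left₀ (abs_nonneg _) him 2
    linarith
  have h3 : ‖z - a‖ / 2 ≤ ‖z‖ := by
    have := norm_sub_le z (a : ℂ)
    rw [Complex.norm_real, Real.norm_eq_abs, abs_of_nonneg ha0] at this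
    linarith
  exact ⟨h1, h2, h3, norm_pos_iff.1 (by linarith)⟩

/-- `1/N^p ≤ (2/δ)^{p−2}/N²` for `N ≥ δ/2 > 0`, `p ≥ 2`. [folklore] -/
theorem one_div_pow_le {N δ : ℝ} (hδ : 0 < δ) (hN : δ / 2 ≤ N) {p : ℕ} (hp : 2 ≤ p) :
    1 / N ^ p ≤ (2 / δ) ^ (p - 2) * (1 / N ^ 2) := by
  obtain ⟨r, rfl⟩ : ∃ r, p = r + 2 := ⟨p - 2, by omega⟩
  have hN0 : 0 < N := by linarith
  rw [Nat.add_sub_cancel, show (1 : ℝ) / N ^ (r + 2) = (1 / N) ^ r * (1 / N ^ 2) by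
    rw [div_pow, one_pow, pow_add]; field_simp]
  refine mul_le_mul_of_nonneg_right (pow_le_pow_left₀ (by positivity) ?_ r) (by positivity)
  rw [div_le_div_iff₀ hN0 hδ]; linarith

/-- The far-zero coefficient
`C_far = 2h₀α/L + Σ_{1≤j<k} |h^{(j)}(0)|(2/δ)^{j−1}/L^j + x₀M_k e^{αx₀}(2/δ)^{k−2}/L^{k−1}`: under the
geometry of `far_geometry`, `m·‖F₀(s−ρ)‖ ≤ C_far · m · 2/((δ/2)² + (γ − t)²)`.
[cite: HeathBrown1992PLMS, Lemma 5.2 (proof)] -/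
theorem far_term_le {x₀ ε₂ ε₀ L α : ℝ} (hε : 0 < ε₂) (hεx : ε₂ ≤ x₀) (hL : 0 < L) (hα : 0 ≤ α)
    {k : ℕ} (hk : 2 ≤ k) {Mk : ℝ} (hM : ∀ u ∈ Icc 0 x₀, |iteratedDeriv k (shape x₀ ε₂ ε₀) u| ≤ Mk)
    {σ₀ t δ : ℝ} (hσ₀ : 1 < σ₀) (hδ : 0 < δ) (hαL : α / L ≤ δ / 4)
    (hc : |σ₀ - α / L - 1| ≤ δ / 4) {ρ : ℂ} (hρ1 : ρ.re < 1) (hfar : δ < ‖ρ - (1 + t * I)‖)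
    {m : ℝ} (hm : 0 ≤ m) :
    m * ‖fordLaplace₀ (testFn x₀ ε₂ ε₀ L α) ((σ₀ : ℂ) + t * I - ρ)‖ ≤
      (2 * shape x₀ ε₂ ε₀ 0 * (α / L) +
        ∑ j ∈ Finset.Ico 1 k, |iteratedDeriv j (shape x₀ ε₂ ε₀) 0| * (2 / δ) ^ (j - 1) / L ^ j +
        x₀ * Mk * Real.exp (α * x₀) * (2 / δ) ^ (k - 2) / L ^ (k - 1)) *
      (m * (2 / ((δ / 2) ^ 2 + (ρ.im - t) ^ 2))) := by
  have hx₀ : 0 ≤ x₀ := hε.le.trans hεx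
  set z : ℂ := (σ₀ : ℂ) + t * I - ρ with hz
  obtain ⟨g1, g2, g3, g4⟩ := far_geometry (σ₀ := σ₀) (t := t) hδ (div_nonneg hα hL.le) hαL hc hfar
  have hcast : ((α / L : ℝ) : ℂ) = (α : ℂ) / L := Complex.ofReal_div α L
  rw [hcast] at g1 g2 g3 g4
  change δ / 2 ≤ ‖z - α / L‖ at g1
  change ((δ / 2) ^ 2 + (ρ.im - t) ^ 2) / 2 ≤ ‖z - α / L‖ ^ 2 at g2
  change ‖z - α / L‖ / 2 ≤ ‖z‖ at g3
  change z - α / L ≠ 0 at g4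
  have hzre : 0 < z.re := by simp [hz]; linarith
  have hk1 : 1 ≤ k := by omega
  have hB := norm_fordLaplace₀_testFn_le_of_re_pos (ε₀ := ε₀) hx₀ hε hL hα hk1 hM hzre g4
  set N := ‖z - α / L‖ with hN
  have hN0 : 0 < N := by linarith
  have hMk0 : 0 ≤ Mk := (abs_nonneg _).trans (hM 0 ⟨le_rfl, hx₀⟩)
  have h0nn : 0 ≤ shape x₀ ε₂ ε₀ 0 := shape_nonneg hε 0
  have hw2 : 1 / N ^ 2 ≤ 2 / ((δ / 2) ^ 2 + (ρ.im - t) ^ 2) := by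
    rw [div_le_div_iff₀ (by positivity) (by positivity)]; linarith
  -- term 1
  have t1 : shape x₀ ε₂ ε₀ 0 * (α / L) / (‖z‖ * N) ≤ 2 * shape x₀ ε₂ ε₀ 0 * (α / L) * (1 / N ^ 2) := by
    have hz0 : 0 < ‖z‖ := by linarith
    have : 1 / (‖z‖ * N) ≤ 2 * (1 / N ^ 2) := by
      rw [mul_one_div, div_le_div_iff₀ (by positivity) (by positivity)]; nlinarith
    calc shape x₀ ε₂ ε₀ 0 * (α / L) / (‖z‖ * N) = shape x₀ ε₂ ε₀ 0 * (α / L) * (1 / (‖z‖ * N)) := by ring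
      _ ≤ shape x₀ ε₂ ε₀ 0 * (α / L) * (2 * (1 / N ^ 2)) := mul_le_mul_of_nonneg_left this (by positivity)
      _ = 2 * shape x₀ ε₂ ε₀ 0 * (α / L) * (1 / N ^ 2) := by ring
  -- terms j
  have t2 : ∑ j ∈ Finset.Ico 1 k, |iteratedDeriv j (shape x₀ ε₂ ε₀) 0| / (L ^ j * N ^ (j + 1)) ≤
      (∑ j ∈ Finset.Ico 1 k, |iteratedDeriv j (shape x₀ ε₂ ε₀) 0| * (2 / δ) ^ (j - 1) / L ^ j) * (1 / N ^ 2) := by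
    rw [Finset.sum_mul]
    refine Finset.sum_le_sum fun j hj ↦ ?_
    have hj1 : 1 ≤ j := (Finset.mem_Ico.1 hj).1
    have hpow := one_div_pow_le hδ g1 (p := j + 1) (by omega)
    rw [show j + 1 - 2 = j - 1 by omega] at hpow
    calc |iteratedDeriv j (shape x₀ ε₂ ε₀) 0| / (L ^ j * N ^ (j + 1))
        = |iteratedDeriv j (shape x₀ ε₂ ε₀) 0| / L ^ j * (1 / N ^ (j + 1)) := by field_simp
      _ ≤ |iteratedDeriv j (shape x₀ ε₂ ε₀) 0| / L ^ j * ((2 / δ) ^ (j - 1) * (1 / N ^ 2)) :=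
          mul_le_mul_of_nonneg_left hpow (by positivity)
      _ = |iteratedDeriv j (shape x₀ ε₂ ε₀) 0| * (2 / δ) ^ (j - 1) / L ^ j * (1 / N ^ 2) := by ring
  -- term k
  have t3 : x₀ * Mk * Real.exp (α * x₀) / (L ^ (k - 1) * N ^ k) ≤
      x₀ * Mk * Real.exp (α * x₀) * (2 / δ) ^ (k - 2) / L ^ (k - 1) * (1 / N ^ 2) := by
    have hpow := one_div_pow_le hδ g1 (p := k) hk
    calc x₀ * Mk * Real.exp (α * x₀) / (L ^ (k - 1) * N ^ k)
        = x₀ * Mk * Real.exp (α * x₀) / L ^ (k - 1) * (1 / N ^ k) := by field_simp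
      _ ≤ x₀ * Mk * Real.exp (α * x₀) / L ^ (k - 1) * ((2 / δ) ^ (k - 2) * (1 / N ^ 2)) :=
          mul_le_mul_of_nonneg_left hpow (by positivity)
      _ = x₀ * Mk * Real.exp (α * x₀) * (2 / δ) ^ (k - 2) / L ^ (k - 1) * (1 / N ^ 2) := by ring
  set Cfar := 2 * shape x₀ ε₂ ε₀ 0 * (α / L) +
    ∑ j ∈ Finset.Ico 1 k, |iteratedDeriv j (shape x₀ ε₂ ε₀) 0| * (2 / δ) ^ (j - 1) / L ^ j +
    x₀ * Mk * Real.exp (α * x₀) * (2 / δ) ^ (k - 2) / L ^ (k - 1) with hCfar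
  have hC0 : 0 ≤ Cfar := by
    rw [hCfar]
    refine add_nonneg (add_nonneg (by positivity) (Finset.sum_nonneg fun j _ ↦ by positivity)) (by positivity)
  have hF : ‖fordLaplace₀ (testFn x₀ ε₂ ε₀ L α) z‖ ≤ Cfar * (1 / N ^ 2) := by
    refine hB.trans ?_
    rw [hCfar]
    nlinarith [t1, t2, t3]
  calc m * ‖fordLaplace₀ (testFn x₀ ε₂ ε₀ L α) z‖ ≤ m * (Cfar * (1 / N ^ 2)) :=
        mul_le_mul_of_nonneg_left hF hm
    _ ≤ m * (Cfar * (2 / ((δ / 2) ^ 2 + (ρ.im - t) ^ 2))) :=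
        mul_le_mul_of_nonneg_left (mul_le_mul_of_nonneg_left hw2 hC0) hm
    _ = Cfar * (m * (2 / ((δ / 2) ^ 2 + (ρ.im - t) ^ 2))) := by ring

/-! ### The far zeros of `L(·, χ)` -/

variable {q : ℕ} [NeZero q] {χ : DirichletCharacter ℂ q}

/-- **Far zeros, `χ`**: there is an absolute `C > 0` such that for primitive `χ` mod `q > 1`,
`g = testFn x₀ ε₂ ε₀ L α` (`k ≥ 2`, `|h^{(k)}| ≤ M_k`), `1 < σ₀ ≤ 5/4`, `0 < δ ≤ 1`, `α/L ≤ δ/4`,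
`|σ₀ − α/L − 1| ≤ δ/4`: `‖Σ_{ρ ∉ nearZeros} m(ρ) F₀(s−ρ)‖ ≤ (C/δ²)(log q + log(|t|+4)) C_far`.
[cite: HeathBrown1992PLMS, Lemma 5.2 (proof) and Lemma 3.3] -/
theorem norm_far_char_le :
    ∃ C : ℝ, 0 < C ∧ ∀ (q : ℕ) [NeZero q] (χ : DirichletCharacter ℂ q) (hprim : χ.IsPrimitive)
      (hq : 1 < q) (x₀ ε₂ ε₀ L α : ℝ), 0 < ε₂ → ε₂ ≤ x₀ → 0 < L → 0 ≤ α →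
      ∀ (k : ℕ) (Mk : ℝ), 2 ≤ k → (∀ u ∈ Icc 0 x₀, |iteratedDeriv k (shape x₀ ε₂ ε₀) u| ≤ Mk) →
      ∀ (σ₀ t δ : ℝ), 1 < σ₀ → 0 < δ → δ ≤ 1 → α / L ≤ δ / 4 → |σ₀ - α / L - 1| ≤ δ / 4 →
        ‖∑' ρ : ↑((nearZeros (ne_one_of_isPrimitive hprim hq) t δ : Set (charNontrivialZeros χ))ᶜ),
            (DirichletDisc.zeroOrder χ ((ρ : charNontrivialZeros χ) : ℂ) : ℂ) *
              fordLaplace₀ (testFn x₀ ε₂ ε₀ L α) ((σ₀ : ℂ) + t * I - (ρ : charNontrivialZeros χ))‖ ≤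
          C / δ ^ 2 * (Real.log q + Real.log (|t| + 4)) *
            (2 * shape x₀ ε₂ ε₀ 0 * (α / L) +
              ∑ j ∈ Finset.Ico 1 k, |iteratedDeriv j (shape x₀ ε₂ ε₀) 0| * (2 / δ) ^ (j - 1) / L ^ j +
              x₀ * Mk * Real.exp (α * x₀) * (2 / δ) ^ (k - 2) / L ^ (k - 1)) := by
  obtain ⟨C, hC0, hC⟩ := exists_tsum_zeroOrder_div_sq_le
  refine ⟨8 * C, by positivity, ?_⟩
  intro q _ χ hprim hq x₀ ε₂ ε₀ L α hε hεx hL hα k Mk hk hM σ₀ t δ hσ₀ hδ hδ1 hαL hc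
  have hχ := ne_one_of_isPrimitive hprim hq
  have hx₀ : 0 ≤ x₀ := hε.le.trans hεx
  set s : ℂ := (σ₀ : ℂ) + t * I with hs
  set g := testFn x₀ ε₂ ε₀ L α with hg
  set Cfar := 2 * shape x₀ ε₂ ε₀ 0 * (α / L) +
    ∑ j ∈ Finset.Ico 1 k, |iteratedDeriv j (shape x₀ ε₂ ε₀) 0| * (2 / δ) ^ (j - 1) / L ^ j +
    x₀ * Mk * Real.exp (α * x₀) * (2 / δ) ^ (k - 2) / L ^ (k - 1) with hCfar
  have hMk0 : 0 ≤ Mk := (abs_nonneg _).trans (hM 0 ⟨le_rfl, hx₀⟩)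
  have hC0' : 0 ≤ Cfar := by
    rw [hCfar]
    have := shape_nonneg (x₀ := x₀) (ε₀ := ε₀) hε 0
    refine add_nonneg (add_nonneg (by positivity) (Finset.sum_nonneg fun j _ ↦ by positivity)) (by positivity)
  -- summability of the zero terms (via the exact formula's lemma) and of the majorant
  have hsre : s.re = σ₀ := by simp [hs]
  have hLs : χ.LFunction s ≠ 0 :=
    DirichletCharacter.LFunction_ne_zero_of_one_le_re χ (Or.inl hχ) (by rw [hsre]; exact hσ₀.le)
  have htest := isSmoothedEFTest_testFn (ε₀ := ε₀) (α := α) hx₀ hε hL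
  have hf := summable_norm_charZeroTerm hprim hq htest (s := s) (by rw [hsre]; linarith) hLs
  obtain ⟨hwsum, hwle⟩ := hC q χ hprim hq t (δ / 2) (by positivity) (by linarith)
  set w : charNontrivialZeros χ → ℝ := fun ρ ↦
    Cfar * ((DirichletDisc.zeroOrder χ (ρ : ℂ) : ℝ) * (2 / ((δ / 2) ^ 2 + ((ρ : ℂ).im - t) ^ 2))) with hw
  have hw0 : ∀ ρ, 0 ≤ w ρ := fun ρ ↦ by positivity
  have hwsum' : Summable w := by
    have := (hwsum.mul_left (2 * Cfar))
    refine this.congr fun ρ ↦ ?_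
    simp only [hw]; ring
  have hle : ∀ ρ : charNontrivialZeros χ, ρ ∉ nearZeros hχ t δ →
      ‖(DirichletDisc.zeroOrder χ (ρ : ℂ) : ℂ) * fordLaplace₀ g (s - ρ)‖ ≤ w ρ := by
    intro ρ hρ
    have hfar : δ < ‖(ρ : ℂ) - (1 + t * I)‖ := by
      by_contra h'; exact hρ (mem_nearZeros.2 (not_lt.1 h'))
    rw [norm_mul, Complex.norm_natCast]
    exact far_term_le hε hεx hL hα hk hM hσ₀ hδ hαL hc ρ.2.2.2 hfar (Nat.cast_nonneg _)
  have key := norm_tsum_compl_le (nearZeros hχ t δ) hf hwsum' hw0 hle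
  refine key.trans ?_
  have htw : ∑' ρ, w ρ = 2 * Cfar * ∑' ρ : charNontrivialZeros χ,
      (DirichletDisc.zeroOrder χ (ρ : ℂ) : ℝ) / ((δ / 2) ^ 2 + ((ρ : ℂ).im - t) ^ 2) := by
    rw [← tsum_mul_left]
    refine tsum_congr fun ρ ↦ ?_
    simp only [hw]; ring
  rw [htw]
  have hlog : 0 ≤ Real.log q + Real.log (|t| + 4) :=
    add_nonneg (Real.log_natCast_nonneg q) (Real.log_nonneg (by linarith [abs_nonneg t]))
  calc 2 * Cfar * ∑' ρ : charNontrivialZeros χ,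
        (DirichletDisc.zeroOrder χ (ρ : ℂ) : ℝ) / ((δ / 2) ^ 2 + ((ρ : ℂ).im - t) ^ 2)
      ≤ 2 * Cfar * (C / (δ / 2) ^ 2 * (Real.log q + Real.log (|t| + 4))) :=
        mul_le_mul_of_nonneg_left hwle (by positivity)
    _ = 8 * C / δ ^ 2 * (Real.log q + Real.log (|t| + 4)) * Cfar := by field_simp; ring

/-! ### The far zeros of `ζ` -/

/-- **Far zeros, `ζ`**: the same bound for `ζ`, with `ℒ = log(|t|+4)`.
[cite: HeathBrown1992PLMS, Lemma 5.3 and Lemma 3.3] -/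
theorem norm_far_zeta_le :
    ∃ C : ℝ, 0 < C ∧ ∀ (x₀ ε₂ ε₀ L α : ℝ), 0 < ε₂ → ε₂ ≤ x₀ → 0 < L → 0 ≤ α →
      ∀ (k : ℕ) (Mk : ℝ), 2 ≤ k → (∀ u ∈ Icc 0 x₀, |iteratedDeriv k (shape x₀ ε₂ ε₀) u| ≤ Mk) →
      ∀ (σ₀ t δ : ℝ), 1 < σ₀ → σ₀ < 3 / 2 → 0 < δ → δ ≤ 1 → α / L ≤ δ / 4 → |σ₀ - α / L - 1| ≤ δ / 4 →
        ‖∑' ρ : ↑((nearZerosZeta t δ : Set RHWave0.riemannZetaNontrivialZeros)ᶜ),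
            (riemannZetaZeroOrder ((ρ : RHWave0.riemannZetaNontrivialZeros) : ℂ) : ℂ) *
              fordLaplace₀ (testFn x₀ ε₂ ε₀ L α)
                ((σ₀ : ℂ) + t * I - (ρ : RHWave0.riemannZetaNontrivialZeros))‖ ≤
          C / δ ^ 2 * Real.log (|t| + 4) *
            (2 * shape x₀ ε₂ ε₀ 0 * (α / L) +
              ∑ j ∈ Finset.Ico 1 k, |iteratedDeriv j (shape x₀ ε₂ ε₀) 0| * (2 / δ) ^ (j - 1) / L ^ j +
              x₀ * Mk * Real.exp (α * x₀) * (2 / δ) ^ (k - 2) / L ^ (k - 1)) := by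
  obtain ⟨C, hC0, hC⟩ := ZetaZeroSum.exists_tsum_zeroOrder_div_sq_le
  refine ⟨8 * C, by positivity, ?_⟩
  intro x₀ ε₂ ε₀ L α hε hεx hL hα k Mk hk hM σ₀ t δ hσ₀ hσ₂ hδ hδ1 hαL hc
  have hx₀ : 0 ≤ x₀ := hε.le.trans hεx
  set s : ℂ := (σ₀ : ℂ) + t * I with hs
  set g := testFn x₀ ε₂ ε₀ L α with hg
  set Cfar := 2 * shape x₀ ε₂ ε₀ 0 * (α / L) +
    ∑ j ∈ Finset.Ico 1 k, |iteratedDeriv j (shape x₀ ε₂ ε₀) 0| * (2 / δ) ^ (j - 1) / L ^ j +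
    x₀ * Mk * Real.exp (α * x₀) * (2 / δ) ^ (k - 2) / L ^ (k - 1) with hCfar
  have hMk0 : 0 ≤ Mk := (abs_nonneg _).trans (hM 0 ⟨le_rfl, hx₀⟩)
  have hC0' : 0 ≤ Cfar := by
    rw [hCfar]
    have := shape_nonneg (x₀ := x₀) (ε₀ := ε₀) hε 0
    refine add_nonneg (add_nonneg (by positivity) (Finset.sum_nonneg fun j _ ↦ by positivity)) (by positivity)
  have hsre : s.re = σ₀ := by simp [hs]
  have hζs : riemannZeta s ≠ 0 := riemannZeta_ne_zero_of_one_lt_re (by rw [hsre]; exact hσ₀)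
  have htest := isSmoothedEFTest_testFn (ε₀ := ε₀) (α := α) hx₀ hε hL
  have hf := SmoothedEF.summable_norm_zeroTerm htest (s := s) (by rw [hsre]; linarith) hζs
  obtain ⟨hwsum, hwle⟩ := hC t (δ / 2) (by positivity) (by linarith)
  set w : RHWave0.riemannZetaNontrivialZeros → ℝ := fun ρ ↦
    Cfar * ((riemannZetaZeroOrder (ρ : ℂ) : ℝ) * (2 / ((δ / 2) ^ 2 + ((ρ : ℂ).im - t) ^ 2))) with hw
  have hw0 : ∀ ρ, 0 ≤ w ρ := fun ρ ↦ by
    have := ZetaZeroSum.zeroOrder_nonneg ρ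
    positivity
  have hwsum' : Summable w := by
    have := (hwsum.mul_left (2 * Cfar))
    refine this.congr fun ρ ↦ ?_
    simp only [hw]; ring
  have hle : ∀ ρ : RHWave0.riemannZetaNontrivialZeros, ρ ∉ nearZerosZeta t δ →
      ‖(riemannZetaZeroOrder (ρ : ℂ) : ℂ) * fordLaplace₀ g (s - ρ)‖ ≤ w ρ := by
    intro ρ hρ
    have hfar : δ < ‖(ρ : ℂ) - (1 + t * I)‖ := by
      by_contra h'; exact hρ (mem_nearZerosZeta.2 (not_lt.1 h'))
    rw [norm_mul, Complex.norm_intCast, abs_of_nonneg (ZetaZeroSum.zeroOrder_nonneg ρ)]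
    exact far_term_le hε hεx hL hα hk hM hσ₀ hδ hαL hc
      (ZetaZeros.riemannZetaNontrivialZeros.re_lt_one ρ.2) hfar (ZetaZeroSum.zeroOrder_nonneg ρ)
  have key := norm_tsum_compl_le (nearZerosZeta t δ) hf hwsum' hw0 hle
  refine key.trans ?_
  have htw : ∑' ρ, w ρ = 2 * Cfar * ∑' ρ : RHWave0.riemannZetaNontrivialZeros,
      (riemannZetaZeroOrder (ρ : ℂ) : ℝ) / ((δ / 2) ^ 2 + ((ρ : ℂ).im - t) ^ 2) := by
    rw [← tsum_mul_left]
    refine tsum_congr fun ρ ↦ ?_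
    simp only [hw]; ring
  rw [htw]
  have hlog : 0 ≤ Real.log (|t| + 4) := Real.log_nonneg (by linarith [abs_nonneg t])
  calc 2 * Cfar * ∑' ρ : RHWave0.riemannZetaNontrivialZeros,
        (riemannZetaZeroOrder (ρ : ℂ) : ℝ) / ((δ / 2) ^ 2 + ((ρ : ℂ).im - t) ^ 2)
      ≤ 2 * Cfar * (C / (δ / 2) ^ 2 * Real.log (|t| + 4)) :=
        mul_le_mul_of_nonneg_left hwle (by positivity)
    _ = 8 * C / δ ^ 2 * Real.log (|t| + 4) * Cfar := by field_simp; ring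

/-! ### The left lines and the trivial zeros -/

/-- The left-line constant `B = 2h₀α/L + 4|h'(0)|/L + 16M₂/L²`: for `Re s ≥ 0` (so `Re(s − w) ≥ 1/2`
on both left lines and at the trivial zeros) and `0 ≤ α ≤ L/4`,
`‖F₀(s − w)‖ ≤ B/((Re s − Re w)² + (Im s − Im w)²)`. [cite: HeathBrown1992PLMS, Lemma 5.1 (F₀(z) ≪ |z|⁻²)] -/
theorem norm_fordLaplace₀_testFn_sub_le {x₀ ε₂ ε₀ L α : ℝ} (hε : 0 < ε₂) (hεx : ε₂ ≤ x₀) (hL : 0 < L)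
    (hα : 0 ≤ α) (hαL : α ≤ L / 4) {M₂ : ℝ}
    (hM : ∀ u ∈ Icc 0 x₀, |iteratedDeriv 2 (shape x₀ ε₂ ε₀) u| ≤ M₂) {s w : ℂ} (hsw : 1 / 2 ≤ s.re - w.re) :
    ‖fordLaplace₀ (testFn x₀ ε₂ ε₀ L α) (s - w)‖ ≤
      (2 * shape x₀ ε₂ ε₀ 0 * (α / L) + 4 * |deriv (shape x₀ ε₂ ε₀) 0| / L + 16 * M₂ / L ^ 2) /
        ((s.re - w.re) ^ 2 + (s.im - w.im) ^ 2) := by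
  have hx₀ : 0 ≤ x₀ := hε.le.trans hεx
  have h := norm_fordLaplace₀_testFn_le_of_half_le_re (ε₀ := ε₀) hx₀ hε hL hα hαL hM (z := s - w)
    (by rw [Complex.sub_re]; exact hsw)
  rwa [Complex.sq_norm, Complex.normSq_apply, Complex.sub_re, Complex.sub_im, ← sq, ← sq] at h

/-- **The left line for `χ`**: `‖J_χ(s)‖ ≤ C·B·(log q + log(1 + |t|))`, `C` the absolute constant of
`exists_norm_charEFRemainder_le`. [cite: HeathBrown1992PLMS, Lemma 5.1 (the line Re w = -1/2)] -/
theorem norm_charEFRemainder_testFn_le :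
    ∃ C : ℝ, 0 < C ∧ ∀ (q : ℕ) [NeZero q] (χ : DirichletCharacter ℂ q), χ.IsPrimitive → 1 < q →
      ∀ (x₀ ε₂ ε₀ L α : ℝ), 0 < ε₂ → ε₂ ≤ x₀ → 0 < L → 0 ≤ α → α ≤ L / 4 →
      ∀ (M₂ : ℝ), (∀ u ∈ Icc 0 x₀, |iteratedDeriv 2 (shape x₀ ε₂ ε₀) u| ≤ M₂) →
      ∀ s : ℂ, 0 ≤ s.re →
        ‖charEFRemainder χ (testFn x₀ ε₂ ε₀ L α) s‖ ≤
          C * (2 * shape x₀ ε₂ ε₀ 0 * (α / L) + 4 * |deriv (shape x₀ ε₂ ε₀) 0| / L + 16 * M₂ / L ^ 2) *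
            (Real.log q + Real.log (1 + |s.im|)) := by
  obtain ⟨C, hC0, hC⟩ := exists_norm_charEFRemainder_le
  refine ⟨C, hC0, fun q _ χ hprim hq x₀ ε₂ ε₀ L α hε hεx hL hα hαL M₂ hM s hs ↦ ?_⟩
  have hx₀ : 0 ≤ x₀ := hε.le.trans hεx
  have hM0 : 0 ≤ M₂ := (abs_nonneg _).trans (hM 0 ⟨le_rfl, hx₀⟩)
  have hB0 : 0 ≤ 2 * shape x₀ ε₂ ε₀ 0 * (α / L) + 4 * |deriv (shape x₀ ε₂ ε₀) 0| / L + 16 * M₂ / L ^ 2 := by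
    have := shape_nonneg (x₀ := x₀) (ε₀ := ε₀) hε 0; positivity
  refine hC q χ hprim hq _ s _ hB0 (by linarith) fun y ↦ ?_
  have h := norm_fordLaplace₀_testFn_sub_le (ε₀ := ε₀) hε hεx hL hα hαL hM (s := s)
    (w := (((-(5 / 2) : ℝ)) : ℂ) + y * I) (by simp; linarith)
  convert h using 2
  simp

/-- **The left line for `ζ`, general form**: there is an absolute `C > 0` with
`‖J(s)‖ ≤ C·B·(1 + log(1 + |Im s|))` whenever `Re s ≥ 0` and
`‖F₀(s − w)‖ ≤ B/((Re s + 1/2)² + (Im s − Im w)²)` on `Re w = −1/2` (the `ζ` analogue of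
`ExplicitPsiChar.exists_norm_charEFRemainder_le`, from `|ζ'/ζ(−1/2+iy)| ≤ C₀ + 2 log(1+|y|)`).
[cite: Ford2002Millennium, Lemma 4.5 ((4.8), the line Re w = -1/2)] -/
theorem exists_norm_smoothedEFRemainder_le :
    ∃ C : ℝ, 0 < C ∧ ∀ (f : ℝ → ℝ) (s : ℂ) (B : ℝ), 0 ≤ B → 0 ≤ s.re →
      (∀ y : ℝ, ‖fordLaplace₀ f (s - ((((-(1 / 2) : ℝ)) : ℂ) + y * I))‖ ≤
        B / ((s.re + 1 / 2) ^ 2 + (s.im - y) ^ 2)) →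
      ‖smoothedEFRemainder f s‖ ≤ C * B * (1 + Real.log (1 + |s.im|)) := by
  obtain ⟨A₀, hA₀0, hA₀⟩ := PsiOneExplicit.exists_norm_logDeriv_riemannZeta_left_le
  set A : ℝ := max A₀ 1 with hAdef
  have hA1 : 1 ≤ A := le_max_right _ _
  have hA : ∀ y : ℝ, ‖deriv riemannZeta ((((-(1 / 2) : ℝ)) : ℂ) + y * I) /
      riemannZeta ((((-(1 / 2) : ℝ)) : ℂ) + y * I)‖ ≤ A + 2 * Real.log (1 + |y|) :=
    fun y ↦ (hA₀ y).trans (by linarith [le_max_left A₀ 1])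
  set K : ℝ := ∫ u : ℝ, (1 + 2 * Real.log (1 + |u|)) / (1 / 4 + u ^ 2) with hK
  have hKint := PsiOneExplicit.integrable_left_majorant (A := 1) zero_le_one
  have hK0 : 0 ≤ K := integral_nonneg fun u ↦ by
    have : 0 ≤ Real.log (1 + |u|) := Real.log_nonneg (by linarith [abs_nonneg u])
    positivity
  refine ⟨(1 / (2 * π)) * K * (A + 2) + 1, by positivity, ?_⟩
  intro f s B hB hσ hF
  set t := s.im with ht
  set a : ℝ := s.re + 1 / 2 with ha
  have ha2 : 1 / 2 ≤ a := by rw [ha]; linarith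
  have hlt0 : 0 ≤ Real.log (1 + |t|) := Real.log_nonneg (by linarith [abs_nonneg t])
  set A' : ℝ := A + 2 * Real.log (1 + |t|) with hA'
  have hA'1 : 1 ≤ A' := by rw [hA']; linarith
  set g : ℝ → ℝ := fun y ↦ B * (A' * ((1 + 2 * Real.log (1 + |y - t|)) / (1 / 4 + (y - t) ^ 2))) with hg
  have hgint : Integrable g := by
    have h1 := (hKint.comp_sub_right t).const_mul (B * A')
    refine h1.congr (ae_of_all _ fun y ↦ ?_)
    simp only [hg]; ring
  have hptw : ∀ y : ℝ, ‖smoothedEFIntegrand f s ((((-(1 / 2) : ℝ)) : ℂ) + y * I)‖ ≤ g y := by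
    intro y
    have hb := hA y
    rw [smoothedEFIntegrand, norm_mul, norm_neg]
    have hFy := hF y
    have hlogy : Real.log (1 + |y|) ≤ Real.log (1 + |t|) + Real.log (1 + |y - t|) :=
      SmoothedEF.log_one_add_abs_le_add y t
    have hly0 : 0 ≤ Real.log (1 + |y - t|) := Real.log_nonneg (by linarith [abs_nonneg (y - t)])
    have hlogy0 : 0 ≤ Real.log (1 + |y|) := Real.log_nonneg (by linarith [abs_nonneg y])
    have hnum : A + 2 * Real.log (1 + |y|) ≤ A' * (1 + 2 * Real.log (1 + |y - t|)) := by
      rw [hA']; nlinarith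
    have hden : (1 / 4 + (y - t) ^ 2) ≤ a ^ 2 + (t - y) ^ 2 := by nlinarith
    have hfrac : B / (a ^ 2 + (t - y) ^ 2) ≤ B / (1 / 4 + (y - t) ^ 2) :=
      div_le_div_of_nonneg_left hB (by positivity) hden
    have hnum0 : 0 ≤ A + 2 * Real.log (1 + |y|) := by positivity
    have hA'0 : 0 ≤ A' * (1 + 2 * Real.log (1 + |y - t|)) := mul_nonneg (by linarith) (by linarith)
    calc ‖deriv riemannZeta ((((-(1 / 2) : ℝ)) : ℂ) + y * I) / riemannZeta ((((-(1 / 2) : ℝ)) : ℂ) + y * I)‖ *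
          ‖fordLaplace₀ f (s - ((((-(1 / 2) : ℝ)) : ℂ) + y * I))‖
        ≤ (A + 2 * Real.log (1 + |y|)) * (B / (a ^ 2 + (t - y) ^ 2)) :=
          mul_le_mul hb (by rw [ha, ht]; exact hFy) (norm_nonneg _) hnum0
      _ ≤ (A' * (1 + 2 * Real.log (1 + |y - t|))) * (B / (1 / 4 + (y - t) ^ 2)) :=
          mul_le_mul hnum hfrac (by positivity) hA'0
      _ = g y := by rw [hg]; ring
  have hI : ‖∫ y : ℝ, smoothedEFIntegrand f s ((((-(1 / 2) : ℝ)) : ℂ) + y * I)‖ ≤ B * (A' * K) := by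
    refine (norm_integral_le_of_norm_le hgint (ae_of_all _ hptw)).trans_eq ?_
    rw [hg, integral_const_mul, integral_const_mul]
    congr 2
    rw [hK]
    exact integral_sub_right_eq_self (fun u : ℝ ↦ (1 + 2 * Real.log (1 + |u|)) / (1 / 4 + u ^ 2)) t
  have hA'le : A' ≤ (A + 2) * (1 + Real.log (1 + |t|)) := by rw [hA']; nlinarith
  rw [smoothedEFRemainder, norm_mul]
  have hπ : ‖(1 / (2 * π) : ℂ)‖ = 1 / (2 * π) := by
    rw [show (1 / (2 * π) : ℂ) = ((1 / (2 * π) : ℝ) : ℂ) by push_cast; ring, Complex.norm_real,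
      Real.norm_eq_abs, abs_of_pos (by positivity)]
  rw [hπ]
  have hL0 : 0 ≤ 1 + Real.log (1 + |t|) := by linarith
  calc 1 / (2 * π) * ‖∫ y : ℝ, smoothedEFIntegrand f s ((((-(1 / 2) : ℝ)) : ℂ) + y * I)‖
      ≤ 1 / (2 * π) * (B * (A' * K)) := mul_le_mul_of_nonneg_left hI (by positivity)
    _ = (1 / (2 * π) * K) * B * A' := by ring
    _ ≤ (1 / (2 * π) * K) * B * ((A + 2) * (1 + Real.log (1 + |t|))) :=
        mul_le_mul_of_nonneg_left hA'le (by positivity)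
    _ = (1 / (2 * π) * K * (A + 2)) * B * (1 + Real.log (1 + |t|)) := by ring
    _ ≤ ((1 / (2 * π)) * K * (A + 2) + 1) * B * (1 + Real.log (1 + |t|)) :=
        mul_le_mul_of_nonneg_right (mul_le_mul_of_nonneg_right (by linarith) hB) hL0

/-- **The left line for `ζ`, test function**: `‖J(s)‖ ≤ C·B·(1 + log(1 + |t|))` for `Re s ≥ 0`,
`0 ≤ α ≤ L/4`. [cite: HeathBrown1992PLMS, Lemma 5.3] -/
theorem norm_smoothedEFRemainder_testFn_le :
    ∃ C : ℝ, 0 < C ∧ ∀ (x₀ ε₂ ε₀ L α : ℝ), 0 < ε₂ → ε₂ ≤ x₀ → 0 < L → 0 ≤ α → α ≤ L / 4 →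
      ∀ (M₂ : ℝ), (∀ u ∈ Icc 0 x₀, |iteratedDeriv 2 (shape x₀ ε₂ ε₀) u| ≤ M₂) →
      ∀ s : ℂ, 0 ≤ s.re →
        ‖smoothedEFRemainder (testFn x₀ ε₂ ε₀ L α) s‖ ≤
          C * (2 * shape x₀ ε₂ ε₀ 0 * (α / L) + 4 * |deriv (shape x₀ ε₂ ε₀) 0| / L + 16 * M₂ / L ^ 2) *
            (1 + Real.log (1 + |s.im|)) := by
  obtain ⟨C, hC0, hC⟩ := exists_norm_smoothedEFRemainder_le
  refine ⟨C, hC0, fun x₀ ε₂ ε₀ L α hε hεx hL hα hαL M₂ hM s hs ↦ ?_⟩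
  have hx₀ : 0 ≤ x₀ := hε.le.trans hεx
  have hM0 : 0 ≤ M₂ := (abs_nonneg _).trans (hM 0 ⟨le_rfl, hx₀⟩)
  have hB0 : 0 ≤ 2 * shape x₀ ε₂ ε₀ 0 * (α / L) + 4 * |deriv (shape x₀ ε₂ ε₀) 0| / L + 16 * M₂ / L ^ 2 := by
    have := shape_nonneg (x₀ := x₀) (ε₀ := ε₀) hε 0; positivity
  refine hC _ s _ hB0 hs fun y ↦ ?_
  have h := norm_fordLaplace₀_testFn_sub_le (ε₀ := ε₀) hε hεx hL hα hαL hM (s := s)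
    (w := (((-(1 / 2) : ℝ)) : ℂ) + y * I) (by simp; linarith)
  convert h using 2
  simp

/-- **The trivial zeros**: `‖Σ_τ m(τ)F₀(s−τ)‖ ≤ 2B` for `Re s ≥ 1`, `0 ≤ α ≤ L/4`.
[cite: HeathBrown1992PLMS, Lemma 5.1] -/
theorem norm_trivial_testFn_le (hprim : χ.IsPrimitive) (hq : 1 < q) {x₀ ε₂ ε₀ L α : ℝ} (hε : 0 < ε₂)
    (hεx : ε₂ ≤ x₀) (hL : 0 < L) (hα : 0 ≤ α) (hαL : α ≤ L / 4) {M₂ : ℝ}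
    (hM : ∀ u ∈ Icc 0 x₀, |iteratedDeriv 2 (shape x₀ ε₂ ε₀) u| ≤ M₂) {s : ℂ} (hs : 1 ≤ s.re) :
    ‖∑ τ ∈ charTrivialZeroFinset (ne_one_of_isPrimitive hprim hq),
        (DirichletDisc.zeroOrder χ τ : ℂ) * fordLaplace₀ (testFn x₀ ε₂ ε₀ L α) (s - τ)‖ ≤
      2 * (2 * shape x₀ ε₂ ε₀ 0 * (α / L) + 4 * |deriv (shape x₀ ε₂ ε₀) 0| / L + 16 * M₂ / L ^ 2) := by
  have hx₀ : 0 ≤ x₀ := hε.le.trans hεx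
  have hM0 : 0 ≤ M₂ := (abs_nonneg _).trans (hM 0 ⟨le_rfl, hx₀⟩)
  set B := 2 * shape x₀ ε₂ ε₀ 0 * (α / L) + 4 * |deriv (shape x₀ ε₂ ε₀) 0| / L + 16 * M₂ / L ^ 2 with hB
  have hB0 : 0 ≤ B := by have := shape_nonneg (x₀ := x₀) (ε₀ := ε₀) hε 0; positivity
  have hbd : ∀ z : ℂ, 1 / 2 ≤ z.re → 1 ≤ ‖z‖ → ‖fordLaplace₀ (testFn x₀ ε₂ ε₀ L α) z‖ ≤ B := by
    intro z hz hz1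
    refine (norm_fordLaplace₀_testFn_le_of_half_le_re (ε₀ := ε₀) hx₀ hε hL hα hαL hM hz).trans ?_
    rw [← hB]
    exact div_le_self hB0 (by nlinarith)
  refine norm_sum_trivial_le hprim hq hB0 (hbd s (by linarith) (by linarith [Complex.re_le_norm s]))
    (hbd (s + 1) (by simp; linarith) ?_) (hbd (s + 2) (by simp; linarith) ?_)
  · have := Complex.re_le_norm (s + 1); simp at this; linarith
  · have := Complex.re_le_norm (s + 2); simp at this; linarith

/-! ### The inserted `β₁`-term -/

/-- **A large-argument bound for `H`**: for the shape `h` (`|h^{(k)}| ≤ M_k`), `W ≠ 0` with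
`Re W ≥ −a` (`a ≥ 0`): `‖H(W)‖ ≤ Σ_{j<k} |h^{(j)}(0)|/‖W‖^{j+1} + x₀ M_k e^{a x₀}/‖W‖^k`.
[cite: HeathBrown1992PLMS, (6.14)] -/
theorem norm_shapeLaplace_le_of_re_ge {x₀ ε₂ ε₀ : ℝ} (hε : 0 < ε₂) (hεx : ε₂ ≤ x₀) {k : ℕ} {Mk : ℝ}
    (hM : ∀ u ∈ Icc 0 x₀, |iteratedDeriv k (shape x₀ ε₂ ε₀) u| ≤ Mk) {W : ℂ} (hW : W ≠ 0) {a : ℝ}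
    (ha : 0 ≤ a) (hWa : -a ≤ W.re) :
    ‖shapeLaplace (shape x₀ ε₂ ε₀) x₀ W‖ ≤
      ∑ j ∈ Finset.range k, |iteratedDeriv j (shape x₀ ε₂ ε₀) 0| / ‖W‖ ^ (j + 1) +
        x₀ * Mk * Real.exp (a * x₀) / ‖W‖ ^ k := by
  have hx₀ : 0 ≤ x₀ := hε.le.trans hεx
  have hMk0 : 0 ≤ Mk := (abs_nonneg _).trans (hM 0 ⟨le_rfl, hx₀⟩)
  have hrem := norm_shapeLaplace_sub_sum_le_crude (shape_contDiff x₀ ε₂ ε₀) hx₀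
    (fun t ht ↦ shape_eq_zero hε ht) hM hW
  have hmax : max 0 (-W.re) ≤ a := max_le ha (by linarith)
  have hsum : ‖∑ j ∈ Finset.range k, ((iteratedDeriv j (shape x₀ ε₂ ε₀) 0 : ℝ) : ℂ) / W ^ (j + 1)‖ ≤
      ∑ j ∈ Finset.range k, |iteratedDeriv j (shape x₀ ε₂ ε₀) 0| / ‖W‖ ^ (j + 1) := by
    refine (norm_sum_le _ _).trans (le_of_eq (Finset.sum_congr rfl fun j _ ↦ ?_))
    rw [norm_div, Complex.norm_real, Real.norm_eq_abs, norm_pow]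
  have h1 := norm_sub_norm_le (shapeLaplace (shape x₀ ε₂ ε₀) x₀ W)
    (∑ j ∈ Finset.range k, ((iteratedDeriv j (shape x₀ ε₂ ε₀) 0 : ℝ) : ℂ) / W ^ (j + 1))
  have h2 : x₀ * Mk * Real.exp (max 0 (-W.re) * x₀) / ‖W‖ ^ k ≤ x₀ * Mk * Real.exp (a * x₀) / ‖W‖ ^ k := by
    refine div_le_div_of_nonneg_right ?_ (by positivity)
    exact mul_le_mul_of_nonneg_left (Real.exp_le_exp.2 (mul_le_mul_of_nonneg_right hmax hx₀)) (by positivity)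
  linarith

end DHTest

end Literature.NumberTheory.LFunctions

end
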